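import Summits.QuantumFields.YangMills.Theorems.BalabanUVNodesSpineReadingOfRecord13CoPHKComponentSize
import Summits.QuantumFields.YangMills.Theorems.BalabanUVNodesN20KeyedRelWeightAtKeyReading

/-!
# THE LEVEL SOCKETS OF THE COMPONENT-SIZE BAD-KEY READING — at a step-preserving key reading `kr`, the bad mass of
# `badKeyReadingOfBigComponent₁₃ N K₀ jcut big` is at most the SUM OVER THE LEVELS `1 ≤ j ≤ jcut K` of the masses of the per-level events «`Z_j` has a big component»
# (a union bound — no age map, no disjointness), so PER-LEVEL big-component FRACTIONS `a K j ∕ b K j` (letters; hypotheses) PRODUCE the N20 face there with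
# `W K = Σ_{j ≤ jcut K} max (a K j) (b K j)`

Cell `pub-ymgap`, YM-PLAN Track A (HUMAN RULING D-0062; width push D-0149); seat `pub-ymgap-dag-n20-d` (R134 (a) N20 NE7b s3 = the U5d ∕ `crOfRecord₁₃` lineage, its declarer)
gen 32; companion of `Thm/BalabanUVNodesSpineReadingOfRecord13CoPHKComponentSize` (p702765: `BigDial₁₃ ∕ badKeyReadingOfBigComponent₁₃ ∕ bigDialOfCard₁₃`, `mem_bad_bigComponent_iff`,
`relWeightBound_bigComponent_of_cut`), `Literature/…/Node00/TwoRunSiteComponentSize` (p701796: `HasBigComponent ∕ KeyBigOldComponent ∕ bigOfCard`) and dag-n20-w2's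
`Thm/BalabanUVNodesN20KeyedRelWeightAtKeyReading` (p610465: `fst_eq_of_mem_classSetK₁₃` — a step-preserving dial keeps the step component — cited BY NAME).  `--kind proof --supports
stmt-QuantumFields-27366 --as helper` (K3⁸); COUNT-NEUTRAL; THEOREMS ONLY (0 `def`).  Bus: INTENT-2 (pub-ymgap INBOX l.45984; first refusal offered to dag-n20-w1∕w2∕w3, whose
(t4)-class object this is — their lanes silent since 08-28 15:54Z).
WHY.  At the level-CUT reading of record the per-birth-level sockets exist (dag-n20-w2 `…N20KeyedRelWeightAtKeyReading` §3 `W_crOfRecord₁₃KAt_le_sum_levels`: strata «born AT level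
`j`»), and the level-1 stratum letter is ≍ 1 under first-level saturation (`…PolicyWall`): the wall.  At the component-SIZE reading the per-level event is «`Z_j` has a component
big for level `j`» — for a growing size threshold a Peierls-shaped RARE event per level, NOT excluded by saturation — and the bad class is the UNION of these events over
`1 ≤ j ≤ jcut K` (not a disjoint stratification: a key may carry big components at several levels).  This file types the union-bound socket such a per-level estimate plugs
into; nothing inhabits the letters today.
WHAT IS HERE.  §1 ★ `sum_bad_bigComponent_le_sum_levels` ([folklore] union bound over levels for a non-negative summand at a step-preserving dial; the per-level event written
as the bad-key reading `fun _ u ↦ HasBigComponent SiteTouch (big … u.1 j) (u.2.2 j)ᶜ` (dial read at the key's own step, as every `BadKeyReading₁₃`), so every class is a `badClassK₁₃` and no new `def` is needed), the two bad-mass bounds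
`badMass_bigComponent_le_of_levelLetters_left ∕ _right`; §2 ★★ `relWeightBound_bigComponent_of_levelLetters` (the face PRODUCED from the letters: `0 ≤ a, b`, per-level
fractions in both runs, `Σ_j max (a K j) (b K j) < 1`, summable in `K`), ★ `W_crOfRecord₁₃KAt_bigComponent_le_sum_levels` (per step, the reading's canonical `W K ≤ Σ_j max …`
from the fractions alone — `SpineCanonicalWeights.wInf_le_of_mem`), ★ `relWeightBound_crOfRecord₁₃KAt_bigComponent_of_levelLetters` (at the reading, canonical `W`); §3 the
cardinality instance `bigDialOfCard₁₃ K₀ m` spelled out (`relWeightBound_card_of_levelLetters`).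
HONEST FRAMING.  [folklore] finite-sum bookkeeping BY NAME; the letters `a`, `b` are HYPOTHESES — the per-level big-component fraction bound is a Peierls-type COUNT against
`exp(−O(1)p₀(g_j)²·m)` under Bałaban's densities, NOT PRINTED as a two-run statement, NOT proved, and inhabited for no family today (A6-shaped); NO weight is bounded here, NO
estimate proved; nothing of Bałaban's asserted; NE7 ∕ NE7b ∕ NE7c NOT PRINTED for `d = 4` ∕ NOT proved; no `Provisos₁₃CoPH` inhabitant claimed (K0⁷ OPEN); K3⁸ v7 untouched (a
dial VALUE; nothing re-pinned); N19 ∕ N20 ∕ N21 ∕ N27 NOT discharged; counts UNMOVED (typed 28∕28 · discharged 8∕27); one finite four-torus programme at fixed `ε` — NOT ℝ⁴, NOT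
OS, NOT a mass gap, NOT the Clay problem.  No `def`, no `instance`, no `notation`, no `sorry`; no decl below carries a cite tag.
-/

noncomputable section

open scoped BigOperators
open Finset

namespace YMDAG.UVSplit

open Literature.MathematicalPhysics.QuantumFieldTheory.Balaban1983to89
open Literature.MathematicalPhysics.QuantumFieldTheory.Balaban1983to89.T4Continuum
open Literature.MathematicalPhysics.QuantumFieldTheory.Balaban1983to89.Node00
open T4WeightBudget (RelWeightBound)
open Summit.QuantumFields.YangMills.BalabanUVNodes.SpineCanonicalWeights (wInf_le_of_mem)
open Summit.QuantumFields.YangMills.BalabanUVNodes.N21KeyedShellWeightShellZero (weightA₁₃_nonneg weightB₁₃_nonneg)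
open Summit.QuantumFields.YangMills.BalabanUVNodes.N20KeyedRelWeightAtKeyReading (fst_eq_of_mem_classSetK₁₃)

variable {F : T4Family} {N : ℕ} [NeZero N]

/-! ## §1 The union bound over levels at a step-preserving dial -/

section Levels

variable (θ : Stage13HParams F N) (hP : θ.Provisos₁₃CoPH F N) (K₀ : ℕ) (g₀ : ℕ → ℝ) (os : List (ULoop F))
  (kr : ℕ → (Σ K, SiteSeqKey F (K₀ + K)) → (Σ K, SiteSeqKey F (K₀ + K))) (jcut : ℕ → ℕ) (big : BigDial₁₃ N K₀)

/-- **A BAD CLASS LIES IN SOME LEVEL EVENT**: at a step-preserving dial, a coarse class booked by the component-size reading carries a big component at SOME level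
`1 ≤ j ≤ jcut K` — it lies in the coarse bad class of the per-level event reading `fun _ u ↦ HasBigComponent SiteTouch (big … u.1 j) (u.2.2 j)ᶜ` (the dial read at the key's own step). [bookkeeping] -/
theorem exists_level_of_mem_bad_bigComponent (hkr : ∀ (K : ℕ) (x : Σ K, SiteSeqKey F (K₀ + K)), x ∈ classSet₁₃ θ K₀ g₀ K → (kr K x).1 = K) (K : ℕ) (t : ℝ)
    {u : Σ K, SiteSeqKey F (K₀ + K)} (hu : u ∈ badClassK₁₃ θ K₀ g₀ kr (badKeyReadingOfBigComponent₁₃ N K₀ jcut big F θ hP g₀ os) K t) :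
    ∃ j ∈ Finset.Icc 1 (jcut K), u ∈ badClassK₁₃ θ K₀ g₀ kr (fun _ u => HasBigComponent SiteTouch (big F θ hP g₀ os u.1 j) (u.2.2 j)ᶜ) K t := by
  obtain ⟨huS, j, h1, hj, hb⟩ := (mem_bad_bigComponent_iff θ hP K₀ g₀ os kr jcut big K t u).1 hu
  have hu1 : u.1 = K := fst_eq_of_mem_classSetK₁₃ θ K₀ g₀ kr hkr K huS
  exact ⟨j, Finset.mem_Icc.2 ⟨h1, hu1 ▸ hj⟩, (mem_badClassK₁₃_iff θ K₀ g₀ kr _ K t u).2 ⟨huS, hb⟩⟩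

/-- Conversely every level event below the cut is booked: the per-level event class at `1 ≤ j ≤ jcut K` lies in the component-size bad class. [bookkeeping] -/
theorem bad_level_subset_bad_bigComponent (hkr : ∀ (K : ℕ) (x : Σ K, SiteSeqKey F (K₀ + K)), x ∈ classSet₁₃ θ K₀ g₀ K → (kr K x).1 = K) (K : ℕ) (t : ℝ) {j : ℕ}
    (hj : j ∈ Finset.Icc 1 (jcut K)) :
    badClassK₁₃ θ K₀ g₀ kr (fun _ u => HasBigComponent SiteTouch (big F θ hP g₀ os u.1 j) (u.2.2 j)ᶜ) K t ⊆
      badClassK₁₃ θ K₀ g₀ kr (badKeyReadingOfBigComponent₁₃ N K₀ jcut big F θ hP g₀ os) K t := by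
  intro u hu
  obtain ⟨huS, hb⟩ := (mem_badClassK₁₃_iff θ K₀ g₀ kr _ K t u).1 hu
  have hu1 : u.1 = K := fst_eq_of_mem_classSetK₁₃ θ K₀ g₀ kr hkr K huS
  obtain ⟨h1, hjK⟩ := Finset.mem_Icc.1 hj
  exact (mem_bad_bigComponent_iff θ hP K₀ g₀ os kr jcut big K t u).2 ⟨huS, j, h1, hu1.symm ▸ hjK, hb⟩

/-- ★ **THE UNION BOUND OVER LEVELS** ([folklore]; step-preserving dial; non-negative summand on the coarse class set): the sum over the component-size bad class is at most the
sum over the levels `1 ≤ j ≤ jcut K` of the sums over the per-level event classes.  No disjointness is used or claimed (a key may carry big components at several levels).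
[bookkeeping] -/
theorem sum_bad_bigComponent_le_sum_levels (hkr : ∀ (K : ℕ) (x : Σ K, SiteSeqKey F (K₀ + K)), x ∈ classSet₁₃ θ K₀ g₀ K → (kr K x).1 = K) (K : ℕ) (t : ℝ)
    (f : (Σ K, SiteSeqKey F (K₀ + K)) → ℝ) (hf : ∀ u ∈ classSetK₁₃ θ K₀ g₀ kr K, 0 ≤ f u) :
    ∑ u ∈ badClassK₁₃ θ K₀ g₀ kr (badKeyReadingOfBigComponent₁₃ N K₀ jcut big F θ hP g₀ os) K t, f u ≤
      ∑ j ∈ Finset.Icc 1 (jcut K), ∑ u ∈ badClassK₁₃ θ K₀ g₀ kr (fun _ u => HasBigComponent SiteTouch (big F θ hP g₀ os u.1 j) (u.2.2 j)ᶜ) K t, f u := by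
  classical
  set S := classSetK₁₃ θ K₀ g₀ kr K with hS
  set Bd := badClassK₁₃ θ K₀ g₀ kr (badKeyReadingOfBigComponent₁₃ N K₀ jcut big F θ hP g₀ os) K t with hBd
  set Bj : ℕ → Finset (Σ K, SiteSeqKey F (K₀ + K)) := fun j =>
    badClassK₁₃ θ K₀ g₀ kr (fun _ u => HasBigComponent SiteTouch (big F θ hP g₀ os u.1 j) (u.2.2 j)ᶜ) K t with hBj
  have hsubBd : Bd ⊆ S := badClassK₁₃_subset θ K₀ g₀ kr _ K t
  have hsubBj : ∀ j, Bj j ⊆ S := fun j => badClassK₁₃_subset θ K₀ g₀ kr _ K t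
  have hcover : ∀ u ∈ Bd, ∃ j ∈ Finset.Icc 1 (jcut K), u ∈ Bj j := fun u hu =>
    exists_level_of_mem_bad_bigComponent θ hP K₀ g₀ os kr jcut big hkr K t hu
  calc ∑ u ∈ Bd, f u ≤ ∑ u ∈ Bd, ∑ j ∈ Finset.Icc 1 (jcut K), (if u ∈ Bj j then f u else 0) := by
        refine Finset.sum_le_sum fun u hu => ?_
        obtain ⟨j, hj, huj⟩ := hcover u hu
        have h0 : ∀ j' ∈ Finset.Icc 1 (jcut K), 0 ≤ (if u ∈ Bj j' then f u else 0) := fun j' _ => by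
          split_ifs
          · exact hf u (hsubBd hu)
          · exact le_rfl
        calc f u = (if u ∈ Bj j then f u else 0) := (if_pos huj).symm
          _ ≤ ∑ j' ∈ Finset.Icc 1 (jcut K), (if u ∈ Bj j' then f u else 0) :=
            Finset.single_le_sum (f := fun j' => if u ∈ Bj j' then f u else 0) h0 hj
    _ ≤ ∑ u ∈ S, ∑ j ∈ Finset.Icc 1 (jcut K), (if u ∈ Bj j then f u else 0) :=
        Finset.sum_le_sum_of_subset_of_nonneg hsubBd fun u huS _ => Finset.sum_nonneg fun j' _ => by
          split_ifs
          · exact hf u huS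
          · exact le_rfl
    _ = ∑ j ∈ Finset.Icc 1 (jcut K), ∑ u ∈ S, (if u ∈ Bj j then f u else 0) := Finset.sum_comm
    _ = ∑ j ∈ Finset.Icc 1 (jcut K), ∑ u ∈ Bj j, f u := by
        refine Finset.sum_congr rfl fun j _ => ?_
        rw [Finset.sum_ite_mem, Finset.inter_eq_right.2 (hsubBj j)]

/-- **RUN A's BAD MASS FROM PER-LEVEL FRACTIONS**: if at every level `1 ≤ j ≤ jcut K` the event class weighs at most the fraction `a K j` of run A's total, the component-size bad
class weighs at most `Σ_j a K j` of it (coarse weights of a Stage-13 tuple with core provisos are `≥ 0`). [bookkeeping] -/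
theorem badMass_bigComponent_le_of_levelLetters_left (hkr : ∀ (K : ℕ) (x : Σ K, SiteSeqKey F (K₀ + K)), x ∈ classSet₁₃ θ K₀ g₀ K → (kr K x).1 = K)
    {a : ℕ → ℕ → ℝ} (K : ℕ) {t : ℝ}
    (hA : ∀ j ∈ Finset.Icc 1 (jcut K), ∑ u ∈ badClassK₁₃ θ K₀ g₀ kr (fun _ u => HasBigComponent SiteTouch (big F θ hP g₀ os u.1 j) (u.2.2 j)ᶜ) K t,
        weightAK₁₃ θ hP K₀ g₀ os kr K t u ≤ a K j * ∑ u ∈ classSetK₁₃ θ K₀ g₀ kr K, weightAK₁₃ θ hP K₀ g₀ os kr K t u) :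
    ∑ u ∈ badClassK₁₃ θ K₀ g₀ kr (badKeyReadingOfBigComponent₁₃ N K₀ jcut big F θ hP g₀ os) K t, weightAK₁₃ θ hP K₀ g₀ os kr K t u ≤
      (∑ j ∈ Finset.Icc 1 (jcut K), a K j) * ∑ u ∈ classSetK₁₃ θ K₀ g₀ kr K, weightAK₁₃ θ hP K₀ g₀ os kr K t u := by
  rw [Finset.sum_mul]
  exact (sum_bad_bigComponent_le_sum_levels θ hP K₀ g₀ os kr jcut big hkr K t _
    (fun u _ => weightAK₁₃_nonneg θ hP K₀ g₀ os kr (fun x _ => weightA₁₃_nonneg F θ hP K₀ g₀ os K t x) u)).trans (Finset.sum_le_sum hA)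

/-- **RUN B's BAD MASS FROM PER-LEVEL FRACTIONS**, likewise. [bookkeeping] -/
theorem badMass_bigComponent_le_of_levelLetters_right (hkr : ∀ (K : ℕ) (x : Σ K, SiteSeqKey F (K₀ + K)), x ∈ classSet₁₃ θ K₀ g₀ K → (kr K x).1 = K)
    {b : ℕ → ℕ → ℝ} (K : ℕ) {t : ℝ}
    (hB : ∀ j ∈ Finset.Icc 1 (jcut K), ∑ u ∈ badClassK₁₃ θ K₀ g₀ kr (fun _ u => HasBigComponent SiteTouch (big F θ hP g₀ os u.1 j) (u.2.2 j)ᶜ) K t,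
        weightBK₁₃ θ hP K₀ g₀ os kr K t u ≤ b K j * ∑ u ∈ classSetK₁₃ θ K₀ g₀ kr K, weightBK₁₃ θ hP K₀ g₀ os kr K t u) :
    ∑ u ∈ badClassK₁₃ θ K₀ g₀ kr (badKeyReadingOfBigComponent₁₃ N K₀ jcut big F θ hP g₀ os) K t, weightBK₁₃ θ hP K₀ g₀ os kr K t u ≤
      (∑ j ∈ Finset.Icc 1 (jcut K), b K j) * ∑ u ∈ classSetK₁₃ θ K₀ g₀ kr K, weightBK₁₃ θ hP K₀ g₀ os kr K t u := by
  rw [Finset.sum_mul]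
  exact (sum_bad_bigComponent_le_sum_levels θ hP K₀ g₀ os kr jcut big hkr K t _
    (fun u _ => weightBK₁₃_nonneg θ hP K₀ g₀ os kr (fun x _ => weightB₁₃_nonneg F θ hP K₀ g₀ os K t x) u)).trans (Finset.sum_le_sum hB)

/-! ## §2 The N20 face at the component-size reading PRODUCED from per-level letters -/

/-- ★★ **THE N20 FACE FROM PER-LEVEL BIG-COMPONENT FRACTIONS** (step-preserving dial): non-negative letters `a K j`, `b K j` bounding, in run A resp. run B, the weight fraction
of the level-`j` event «`Z_j` has a big component» for `1 ≤ j ≤ jcut K`, with `Σ_{j ≤ jcut K} max (a K j) (b K j) < 1` and summable in `K`, give `RelWeightBound` at the coarse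
carriers with the component-size bad class and `W K := Σ_{j ≤ jcut K} max (a K j) (b K j)`.  The letters are HYPOTHESES (a Peierls count per level; not printed, not proved).
[bookkeeping] -/
theorem relWeightBound_bigComponent_of_levelLetters (hkr : ∀ (K : ℕ) (x : Σ K, SiteSeqKey F (K₀ + K)), x ∈ classSet₁₃ θ K₀ g₀ K → (kr K x).1 = K)
    {a b : ℕ → ℕ → ℝ} (ha0 : ∀ K j, 0 ≤ a K j)
    (hA : ∀ (K : ℕ) (t : ℝ), |t| ≤ 1 → ∀ j ∈ Finset.Icc 1 (jcut K),
      ∑ u ∈ badClassK₁₃ θ K₀ g₀ kr (fun _ u => HasBigComponent SiteTouch (big F θ hP g₀ os u.1 j) (u.2.2 j)ᶜ) K t, weightAK₁₃ θ hP K₀ g₀ os kr K t u ≤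
        a K j * ∑ u ∈ classSetK₁₃ θ K₀ g₀ kr K, weightAK₁₃ θ hP K₀ g₀ os kr K t u)
    (hB : ∀ (K : ℕ) (t : ℝ), |t| ≤ 1 → ∀ j ∈ Finset.Icc 1 (jcut K),
      ∑ u ∈ badClassK₁₃ θ K₀ g₀ kr (fun _ u => HasBigComponent SiteTouch (big F θ hP g₀ os u.1 j) (u.2.2 j)ᶜ) K t, weightBK₁₃ θ hP K₀ g₀ os kr K t u ≤
        b K j * ∑ u ∈ classSetK₁₃ θ K₀ g₀ kr K, weightBK₁₃ θ hP K₀ g₀ os kr K t u)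
    (hlt : ∀ K, ∑ j ∈ Finset.Icc 1 (jcut K), max (a K j) (b K j) < 1) (hsum : Summable fun K => ∑ j ∈ Finset.Icc 1 (jcut K), max (a K j) (b K j)) :
    RelWeightBound 1 (classSetK₁₃ θ K₀ g₀ kr) (weightAK₁₃ θ hP K₀ g₀ os kr) (weightBK₁₃ θ hP K₀ g₀ os kr)
      (badClassK₁₃ θ K₀ g₀ kr (badKeyReadingOfBigComponent₁₃ N K₀ jcut big F θ hP g₀ os)) (fun K => ∑ j ∈ Finset.Icc 1 (jcut K), max (a K j) (b K j)) where
  bad_subset K t _ := badClassK₁₃_subset θ K₀ g₀ kr _ K t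
  nonneg K := Finset.sum_nonneg fun j _ => (ha0 K j).trans (le_max_left _ _)
  lt_one := hlt
  summable := hsum
  bad_left K t ht :=
    (badMass_bigComponent_le_of_levelLetters_left θ hP K₀ g₀ os kr jcut big hkr K (hA K t ht)).trans
      (mul_le_mul_of_nonneg_right (Finset.sum_le_sum fun _ _ => le_max_left _ _)
        (Finset.sum_nonneg fun u _ => weightAK₁₃_nonneg θ hP K₀ g₀ os kr (fun x _ => weightA₁₃_nonneg F θ hP K₀ g₀ os K t x) u))
  bad_right K t ht :=
    (badMass_bigComponent_le_of_levelLetters_right θ hP K₀ g₀ os kr jcut big hkr K (hB K t ht)).trans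
      (mul_le_mul_of_nonneg_right (Finset.sum_le_sum fun _ _ => le_max_right _ _)
        (Finset.sum_nonneg fun u _ => weightBK₁₃_nonneg θ hP K₀ g₀ os kr (fun x _ => weightB₁₃_nonneg F θ hP K₀ g₀ os K t x) u))

end Levels

section AtReading

variable (K₀ : ℕ) (kr : KeyReading₁₃ N K₀) (jcut : ℕ → ℕ) (big : BigDial₁₃ N K₀) (sh : ShellSplit₁₃CoPH N K₀) (θ : Stage13HParams F N)
  (hP : θ.Provisos₁₃CoPH F N) (g₀ : ℕ → ℝ) (os : List (ULoop F))

/-- ★ **THE READING's CANONICAL WEIGHT IS AT MOST THE SUM OF THE PER-LEVEL LETTERS, STEP BY STEP** — from the per-level fractions at ONE step `K` alone (no `< 1`, no summability):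
`(crOfRecord₁₃KAt K₀ kr (badKeyReadingOfBigComponent₁₃ N K₀ jcut big) sh …).W K ≤ Σ_{j ≤ jcut K} max (a K j) (b K j)` (`SpineCanonicalWeights.wInf_le_of_mem`). [bookkeeping] -/
theorem W_crOfRecord₁₃KAt_bigComponent_le_sum_levels
    (hkr : ∀ (K : ℕ) (x : Σ K, SiteSeqKey F (K₀ + K)), x ∈ classSet₁₃ θ K₀ g₀ K → (kr F θ hP g₀ os K x).1 = K) {a b : ℕ → ℕ → ℝ} (K : ℕ)
    (ha0 : ∀ j ∈ Finset.Icc 1 (jcut K), 0 ≤ a K j)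
    (hA : ∀ t : ℝ, |t| ≤ 1 → ∀ j ∈ Finset.Icc 1 (jcut K),
      ∑ u ∈ badClassK₁₃ θ K₀ g₀ (kr F θ hP g₀ os) (fun _ u => HasBigComponent SiteTouch (big F θ hP g₀ os u.1 j) (u.2.2 j)ᶜ) K t,
          weightAK₁₃ θ hP K₀ g₀ os (kr F θ hP g₀ os) K t u ≤
        a K j * ∑ u ∈ classSetK₁₃ θ K₀ g₀ (kr F θ hP g₀ os) K, weightAK₁₃ θ hP K₀ g₀ os (kr F θ hP g₀ os) K t u)
    (hB : ∀ t : ℝ, |t| ≤ 1 → ∀ j ∈ Finset.Icc 1 (jcut K),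
      ∑ u ∈ badClassK₁₃ θ K₀ g₀ (kr F θ hP g₀ os) (fun _ u => HasBigComponent SiteTouch (big F θ hP g₀ os u.1 j) (u.2.2 j)ᶜ) K t,
          weightBK₁₃ θ hP K₀ g₀ os (kr F θ hP g₀ os) K t u ≤
        b K j * ∑ u ∈ classSetK₁₃ θ K₀ g₀ (kr F θ hP g₀ os) K, weightBK₁₃ θ hP K₀ g₀ os (kr F θ hP g₀ os) K t u) :
    (crOfRecord₁₃KAt K₀ kr (badKeyReadingOfBigComponent₁₃ N K₀ jcut big) sh F θ hP g₀ os).W K ≤ ∑ j ∈ Finset.Icc 1 (jcut K), max (a K j) (b K j) := by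
  refine wInf_le_of_mem ⟨Finset.sum_nonneg fun j hj => (ha0 j hj).trans (le_max_left _ _), fun t ht => ⟨?_, ?_⟩⟩
  · exact (badMass_bigComponent_le_of_levelLetters_left θ hP K₀ g₀ os (kr F θ hP g₀ os) jcut big hkr K (hA t ht)).trans
      (mul_le_mul_of_nonneg_right (Finset.sum_le_sum fun _ _ => le_max_left _ _)
        (Finset.sum_nonneg fun u _ => weightAK₁₃_nonneg θ hP K₀ g₀ os (kr F θ hP g₀ os) (fun x _ => weightA₁₃_nonneg F θ hP K₀ g₀ os K t x) u))
  · exact (badMass_bigComponent_le_of_levelLetters_right θ hP K₀ g₀ os (kr F θ hP g₀ os) jcut big hkr K (hB t ht)).trans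
      (mul_le_mul_of_nonneg_right (Finset.sum_le_sum fun _ _ => le_max_right _ _)
        (Finset.sum_nonneg fun u _ => weightBK₁₃_nonneg θ hP K₀ g₀ os (kr F θ hP g₀ os) (fun x _ => weightB₁₃_nonneg F θ hP K₀ g₀ os K t x) u))

/-- ★ **N20 AT THE COMPONENT-SIZE READING FROM PER-LEVEL LETTERS** (canonical `W = wInf …` of the reading inherits the witness of `relWeightBound_bigComponent_of_levelLetters` by
this lineage's `relWeightBound_crOfRecord₁₃KAt`). [bookkeeping] -/
theorem relWeightBound_crOfRecord₁₃KAt_bigComponent_of_levelLetters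
    (hkr : ∀ (K : ℕ) (x : Σ K, SiteSeqKey F (K₀ + K)), x ∈ classSet₁₃ θ K₀ g₀ K → (kr F θ hP g₀ os K x).1 = K) {a b : ℕ → ℕ → ℝ} (ha0 : ∀ K j, 0 ≤ a K j)
    (hA : ∀ (K : ℕ) (t : ℝ), |t| ≤ 1 → ∀ j ∈ Finset.Icc 1 (jcut K),
      ∑ u ∈ badClassK₁₃ θ K₀ g₀ (kr F θ hP g₀ os) (fun _ u => HasBigComponent SiteTouch (big F θ hP g₀ os u.1 j) (u.2.2 j)ᶜ) K t,
          weightAK₁₃ θ hP K₀ g₀ os (kr F θ hP g₀ os) K t u ≤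
        a K j * ∑ u ∈ classSetK₁₃ θ K₀ g₀ (kr F θ hP g₀ os) K, weightAK₁₃ θ hP K₀ g₀ os (kr F θ hP g₀ os) K t u)
    (hB : ∀ (K : ℕ) (t : ℝ), |t| ≤ 1 → ∀ j ∈ Finset.Icc 1 (jcut K),
      ∑ u ∈ badClassK₁₃ θ K₀ g₀ (kr F θ hP g₀ os) (fun _ u => HasBigComponent SiteTouch (big F θ hP g₀ os u.1 j) (u.2.2 j)ᶜ) K t,
          weightBK₁₃ θ hP K₀ g₀ os (kr F θ hP g₀ os) K t u ≤
        b K j * ∑ u ∈ classSetK₁₃ θ K₀ g₀ (kr F θ hP g₀ os) K, weightBK₁₃ θ hP K₀ g₀ os (kr F θ hP g₀ os) K t u)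
    (hlt : ∀ K, ∑ j ∈ Finset.Icc 1 (jcut K), max (a K j) (b K j) < 1) (hsum : Summable fun K => ∑ j ∈ Finset.Icc 1 (jcut K), max (a K j) (b K j)) :
    RelWeightBound (crOfRecord₁₃KAt K₀ kr (badKeyReadingOfBigComponent₁₃ N K₀ jcut big) sh F θ hP g₀ os).l₀
      (crOfRecord₁₃KAt K₀ kr (badKeyReadingOfBigComponent₁₃ N K₀ jcut big) sh F θ hP g₀ os).T
      (crOfRecord₁₃KAt K₀ kr (badKeyReadingOfBigComponent₁₃ N K₀ jcut big) sh F θ hP g₀ os).A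
      (crOfRecord₁₃KAt K₀ kr (badKeyReadingOfBigComponent₁₃ N K₀ jcut big) sh F θ hP g₀ os).B
      (crOfRecord₁₃KAt K₀ kr (badKeyReadingOfBigComponent₁₃ N K₀ jcut big) sh F θ hP g₀ os).Bad
      (crOfRecord₁₃KAt K₀ kr (badKeyReadingOfBigComponent₁₃ N K₀ jcut big) sh F θ hP g₀ os).W :=
  relWeightBound_crOfRecord₁₃KAt K₀ kr _ sh θ hP g₀ os
    (relWeightBound_bigComponent_of_levelLetters θ hP K₀ g₀ os (kr F θ hP g₀ os) jcut big hkr ha0 hA hB hlt hsum)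

end AtReading

/-! ## §3 The cardinality instance -/

section Card

variable (θ : Stage13HParams F N) (hP : θ.Provisos₁₃CoPH F N) (K₀ : ℕ) (g₀ : ℕ → ℝ) (os : List (ULoop F))
  (kr : ℕ → (Σ K, SiteSeqKey F (K₀ + K)) → (Σ K, SiteSeqKey F (K₀ + K))) (jcut : ℕ → ℕ)

/-- **THE FACE AT THE CARDINALITY DIAL FROM PER-LEVEL LETTERS**: with thresholds `m K j` (finest sites), letters bounding in each run the weight fraction of «at level `j` the
large-field region `Z_j` has a connected component of at least `m K j` finest sites» for `1 ≤ j ≤ jcut K` give the N20 face at the coarse carriers with the bad class of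
`badKeyReadingOfBigComponent₁₃ N K₀ jcut (bigDialOfCard₁₃ K₀ m)`.  Letters = HYPOTHESES. [bookkeeping] -/
theorem relWeightBound_card_of_levelLetters (hkr : ∀ (K : ℕ) (x : Σ K, SiteSeqKey F (K₀ + K)), x ∈ classSet₁₃ θ K₀ g₀ K → (kr K x).1 = K) (m : ℕ → ℕ → ℕ)
    {a b : ℕ → ℕ → ℝ} (ha0 : ∀ K j, 0 ≤ a K j)
    (hA : ∀ (K : ℕ) (t : ℝ), |t| ≤ 1 → ∀ j ∈ Finset.Icc 1 (jcut K),
      ∑ u ∈ badClassK₁₃ θ K₀ g₀ kr (fun _ u => HasBigComponent SiteTouch (bigOfCard (m u.1) j) (u.2.2 j)ᶜ) K t, weightAK₁₃ θ hP K₀ g₀ os kr K t u ≤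
        a K j * ∑ u ∈ classSetK₁₃ θ K₀ g₀ kr K, weightAK₁₃ θ hP K₀ g₀ os kr K t u)
    (hB : ∀ (K : ℕ) (t : ℝ), |t| ≤ 1 → ∀ j ∈ Finset.Icc 1 (jcut K),
      ∑ u ∈ badClassK₁₃ θ K₀ g₀ kr (fun _ u => HasBigComponent SiteTouch (bigOfCard (m u.1) j) (u.2.2 j)ᶜ) K t, weightBK₁₃ θ hP K₀ g₀ os kr K t u ≤
        b K j * ∑ u ∈ classSetK₁₃ θ K₀ g₀ kr K, weightBK₁₃ θ hP K₀ g₀ os kr K t u)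
    (hlt : ∀ K, ∑ j ∈ Finset.Icc 1 (jcut K), max (a K j) (b K j) < 1) (hsum : Summable fun K => ∑ j ∈ Finset.Icc 1 (jcut K), max (a K j) (b K j)) :
    RelWeightBound 1 (classSetK₁₃ θ K₀ g₀ kr) (weightAK₁₃ θ hP K₀ g₀ os kr) (weightBK₁₃ θ hP K₀ g₀ os kr)
      (badClassK₁₃ θ K₀ g₀ kr (badKeyReadingOfBigComponent₁₃ N K₀ jcut (bigDialOfCard₁₃ K₀ m) F θ hP g₀ os))
      (fun K => ∑ j ∈ Finset.Icc 1 (jcut K), max (a K j) (b K j)) :=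
  relWeightBound_bigComponent_of_levelLetters θ hP K₀ g₀ os kr jcut (bigDialOfCard₁₃ K₀ m) hkr ha0 hA hB hlt hsum

end Card

end YMDAG.UVSplit

end
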